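import Summits.AnomalousDissipation.AnomalousDissipation.Theorems.BaireTransferDenseLoudDesignerForcesErgodicModelMixedDerivativeFieldOperator
import Literature.Analysis.FunctionSpaces.TorusGevreyInterpolation

/-!
# The time-derivative field of the smooth model is Fréchet differentiable in the datum, with derivative the candidate
# mixed operator (tools for the registered stub S6c₂ `stub_modelMixedDerivativeFieldTools`, line
# ergodic-budget-selection-closing, block N-R of the crux `DenseLoudDesignerForces`)

Summit-side glue over `…ErgodicModelMixedDerivativeFieldOperator.lean`.  With the time-derivative field written through the
classical solutions, `V(s, y) = S([∂ₜu_y(s)] − [Δ∂ₜu_y(s)])`, and the operator field `Φ` of `exists_mixedOp`, we prove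
`HasFDerivAt (V(s, ·)) (Φ s y) y` on the admissible box (`hasFDerivAt_timeField_frame`): for `h = y' − y`,
`V(s, y') − V(s, y) − Φ s y h = S([X] − [ΔX])`, `X = ∂ₜu_{y'} − ∂ₜu_y − DG(u_y)[w_h] = P(νΔr − (u·∇)r − (r·∇)u − (δ·∇)δ)`
(`Torus.IsClassicalNSSolutionOn.timeDerivWithin_sub_eq_leray`; `δ = u_{y'}(s) − u_y(s)`, `r = δ − w_h`), whose `H¹` size is
`≤ K(ε + D²)` (`Torus.exists_h1_linearisationRemainder_le`) with `D = C₂L²‖h‖²` (Gevrey–Lipschitz) and `ε = o(‖h‖²)` — the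
`H³`-sum of `r`, small by Gevrey interpolation (`Torus.exists_sobolev_le_of_gevreyBound_of_l2_le`) because `r` is
Gevrey-bounded by `4C₂L²‖h‖²` and `∫‖r‖² = ‖S(g s y' − g s y − W h)‖² = o(‖h‖²)`.  Nothing is asserted; no definition is added.
-/

set_option linter.dupNamespace false

noncomputable section

open Set Function MeasureTheory Filter Metric Asymptotics
open scoped InnerProductSpace RealInnerProductSpace Topology ContDiff

namespace Summit.AnomalousDissipation.AnomalousDissipation.Theorems.DenseLoudDesignerForces.Ergodic

open Literature.Analysis.FunctionSpaces Literature.Analysis.FunctionSpaces.Torus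
open Literature.Analysis.FluidPDE Literature.Analysis.FluidPDE.Torus
open Summit.AnomalousDissipation.AnomalousDissipation.Theses.BaireTransfer
open Summit.AnomalousDissipation.AnomalousDissipation.Theorems.DenseLoudDesignerForces.Negative

/-! ## Auxiliary estimates -/

/-- **Gevrey bound of a difference**: `∑ e^{2σ|k|}‖𝓕(v − w)(k)‖² ≤ 2G_v + 2G_w`. [folklore] -/
theorem gevrey_sub_le {v w : (UnitAddTorus (Fin 3)) → (EuclideanSpace ℝ (Fin 3))} (hv : IsSmooth v) (hw : IsSmooth w) {σ Gv Gw : ℝ}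
    (hGv : ∀ S' : Finset (Fin 3 → ℤ), ∑ k ∈ S', Real.exp (2 * σ * Real.sqrt (freqNormSq k)) *
      ‖UnitAddTorus.mFourierCoeff (EuclideanSpace.complexify ∘ v) k‖ ^ 2 ≤ Gv)
    (hGw : ∀ S' : Finset (Fin 3 → ℤ), ∑ k ∈ S', Real.exp (2 * σ * Real.sqrt (freqNormSq k)) *
      ‖UnitAddTorus.mFourierCoeff (EuclideanSpace.complexify ∘ w) k‖ ^ 2 ≤ Gw) (S' : Finset (Fin 3 → ℤ)) :
    ∑ k ∈ S', Real.exp (2 * σ * Real.sqrt (freqNormSq k)) *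
      ‖UnitAddTorus.mFourierCoeff (EuclideanSpace.complexify ∘ fun x => v x - w x) k‖ ^ 2 ≤ 2 * Gv + 2 * Gw := by
  have hk : ∀ k, UnitAddTorus.mFourierCoeff (EuclideanSpace.complexify ∘ fun x => v x - w x) k =
      UnitAddTorus.mFourierCoeff (EuclideanSpace.complexify ∘ v) k - UnitAddTorus.mFourierCoeff (EuclideanSpace.complexify ∘ w) k := by
    intro k
    rw [show (fun x => v x - w x) = v - w from rfl, complexify_comp_sub,
      mFourierCoeff_sub (integrable_complexify_comp hv.integrable) (integrable_complexify_comp hw.integrable)]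
  calc ∑ k ∈ S', Real.exp (2 * σ * Real.sqrt (freqNormSq k)) *
        ‖UnitAddTorus.mFourierCoeff (EuclideanSpace.complexify ∘ fun x => v x - w x) k‖ ^ 2
      ≤ ∑ k ∈ S', (2 * (Real.exp (2 * σ * Real.sqrt (freqNormSq k)) * ‖UnitAddTorus.mFourierCoeff (EuclideanSpace.complexify ∘ v) k‖ ^ 2) +
          2 * (Real.exp (2 * σ * Real.sqrt (freqNormSq k)) * ‖UnitAddTorus.mFourierCoeff (EuclideanSpace.complexify ∘ w) k‖ ^ 2)) := by
        refine Finset.sum_le_sum fun k _ => ?_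
        rw [hk k]
        have h := norm_sub_le (UnitAddTorus.mFourierCoeff (EuclideanSpace.complexify ∘ v) k)
          (UnitAddTorus.mFourierCoeff (EuclideanSpace.complexify ∘ w) k)
        have he : 0 ≤ Real.exp (2 * σ * Real.sqrt (freqNormSq k)) := (Real.exp_pos _).le
        have hsq : ‖UnitAddTorus.mFourierCoeff (EuclideanSpace.complexify ∘ v) k -
            UnitAddTorus.mFourierCoeff (EuclideanSpace.complexify ∘ w) k‖ ^ 2 ≤
            2 * ‖UnitAddTorus.mFourierCoeff (EuclideanSpace.complexify ∘ v) k‖ ^ 2 +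
              2 * ‖UnitAddTorus.mFourierCoeff (EuclideanSpace.complexify ∘ w) k‖ ^ 2 := by
          nlinarith [norm_nonneg (UnitAddTorus.mFourierCoeff (EuclideanSpace.complexify ∘ v) k -
            UnitAddTorus.mFourierCoeff (EuclideanSpace.complexify ∘ w) k),
            norm_nonneg (UnitAddTorus.mFourierCoeff (EuclideanSpace.complexify ∘ v) k),
            norm_nonneg (UnitAddTorus.mFourierCoeff (EuclideanSpace.complexify ∘ w) k),
            sq_nonneg (‖UnitAddTorus.mFourierCoeff (EuclideanSpace.complexify ∘ v) k‖ -
              ‖UnitAddTorus.mFourierCoeff (EuclideanSpace.complexify ∘ w) k‖)]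
        have hm := mul_le_mul_of_nonneg_left hsq he
        linarith
    _ = 2 * ∑ k ∈ S', Real.exp (2 * σ * Real.sqrt (freqNormSq k)) * ‖UnitAddTorus.mFourierCoeff (EuclideanSpace.complexify ∘ v) k‖ ^ 2 +
          2 * ∑ k ∈ S', Real.exp (2 * σ * Real.sqrt (freqNormSq k)) * ‖UnitAddTorus.mFourierCoeff (EuclideanSpace.complexify ∘ w) k‖ ^ 2 := by
        rw [Finset.sum_add_distrib, Finset.mul_sum, Finset.mul_sum]
    _ ≤ 2 * Gv + 2 * Gw := by linarith [hGv S', hGw S']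

/-- **Gevrey interpolation for a scaled family**: if the interpolation threshold `δ₇` of
`Torus.exists_sobolev_le_of_gevreyBound_of_l2_le` (Gevrey level `G`, target `ε'`) is met by `r/t` — `r` smooth with Gevrey
sums `≤ G t²` and `∫‖r‖² ≤ δ₇ t²`, `t > 0` — then the `H³`-sums of `r` are `≤ ε' t²`. [folklore] -/
theorem sobolev_le_of_interp {σ G δ₇ ε' : ℝ}
    (hT7 : ∀ c' : (Fin 3 → ℤ) → EuclideanSpace ℂ (Fin 3),
      (∀ S' : Finset (Fin 3 → ℤ), ∑ k ∈ S', Real.exp (2 * σ * Real.sqrt (freqNormSq k)) * ‖c' k‖ ^ 2 ≤ G) →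
      (∀ S' : Finset (Fin 3 → ℤ), ∑ k ∈ S', ‖c' k‖ ^ 2 ≤ δ₇) →
      ∀ S' : Finset (Fin 3 → ℤ), ∑ k ∈ S', (1 + freqNormSq k) ^ 3 * ‖c' k‖ ^ 2 ≤ ε')
    {r : (UnitAddTorus (Fin 3)) → (EuclideanSpace ℝ (Fin 3))} (hr : IsSmooth r) {t : ℝ} (ht : 0 < t)
    (hG : ∀ S' : Finset (Fin 3 → ℤ), ∑ k ∈ S', Real.exp (2 * σ * Real.sqrt (freqNormSq k)) *
      ‖UnitAddTorus.mFourierCoeff (EuclideanSpace.complexify ∘ r) k‖ ^ 2 ≤ G * t ^ 2)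
    (hL2 : (∫ x, ‖r x‖ ^ 2) ≤ δ₇ * t ^ 2) (S' : Finset (Fin 3 → ℤ)) :
    ∑ k ∈ S', (1 + freqNormSq k) ^ 3 * ‖UnitAddTorus.mFourierCoeff (EuclideanSpace.complexify ∘ r) k‖ ^ 2 ≤ ε' * t ^ 2 := by
  set c' : (Fin 3 → ℤ) → EuclideanSpace ℂ (Fin 3) := fun k => ((t⁻¹ : ℝ) : ℂ) • UnitAddTorus.mFourierCoeff (EuclideanSpace.complexify ∘ r) k
    with hc'
  have ht2 : 0 < t ^ 2 := by positivity
  have hnorm : ∀ k, ‖c' k‖ ^ 2 = (t ^ 2)⁻¹ * ‖UnitAddTorus.mFourierCoeff (EuclideanSpace.complexify ∘ r) k‖ ^ 2 := fun k => by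
    rw [hc', norm_smul, Complex.norm_real, Real.norm_eq_abs, abs_of_pos (inv_pos.2 ht), mul_pow, inv_pow]
  have h1 : ∀ S' : Finset (Fin 3 → ℤ), ∑ k ∈ S', Real.exp (2 * σ * Real.sqrt (freqNormSq k)) * ‖c' k‖ ^ 2 ≤ G := by
    intro S''
    have h := hG S''
    calc ∑ k ∈ S'', Real.exp (2 * σ * Real.sqrt (freqNormSq k)) * ‖c' k‖ ^ 2
        = (t ^ 2)⁻¹ * ∑ k ∈ S'', Real.exp (2 * σ * Real.sqrt (freqNormSq k)) *
            ‖UnitAddTorus.mFourierCoeff (EuclideanSpace.complexify ∘ r) k‖ ^ 2 := by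
          rw [Finset.mul_sum]
          refine Finset.sum_congr rfl fun k _ => ?_
          rw [hnorm k]; ring
      _ ≤ (t ^ 2)⁻¹ * (G * t ^ 2) := mul_le_mul_of_nonneg_left h (inv_nonneg.2 ht2.le)
      _ = G := by field_simp
  have h2 : ∀ S' : Finset (Fin 3 → ℤ), ∑ k ∈ S', ‖c' k‖ ^ 2 ≤ δ₇ := by
    intro S''
    have hP : ∑ k ∈ S'', ‖UnitAddTorus.mFourierCoeff (EuclideanSpace.complexify ∘ r) k‖ ^ 2 ≤ ∫ x, ‖r x‖ ^ 2 :=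
      sum_le_hasSum S'' (fun k _ => sq_nonneg _) (hasSum_sq_norm_mFourierCoeff_complexify (hr.memLp 2))
    calc ∑ k ∈ S'', ‖c' k‖ ^ 2 = (t ^ 2)⁻¹ * ∑ k ∈ S'', ‖UnitAddTorus.mFourierCoeff (EuclideanSpace.complexify ∘ r) k‖ ^ 2 := by
          rw [Finset.mul_sum]
          exact Finset.sum_congr rfl fun k _ => hnorm k
      _ ≤ (t ^ 2)⁻¹ * (δ₇ * t ^ 2) := mul_le_mul_of_nonneg_left (hP.trans hL2) (inv_nonneg.2 ht2.le)
      _ = δ₇ := by field_simp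
  have h3 := hT7 c' h1 h2 S'
  have heq : ∑ k ∈ S', (1 + freqNormSq k) ^ 3 * ‖UnitAddTorus.mFourierCoeff (EuclideanSpace.complexify ∘ r) k‖ ^ 2 =
      t ^ 2 * ∑ k ∈ S', (1 + freqNormSq k) ^ 3 * ‖c' k‖ ^ 2 := by
    rw [Finset.mul_sum]
    refine Finset.sum_congr rfl fun k _ => ?_
    rw [hnorm k]
    field_simp
  rw [heq]
  nlinarith

section Deriv

variable {S : Finset (Fin 3 → ℤ)} {c : ↥S → (EuclideanSpace ℂ (Fin 3))} {ν : ℝ} (F : ModelFrame) (xF : Hsp) {U U' : Set Hsp}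
  (u : Hsp → ℝ → (UnitAddTorus (Fin 3)) → (EuclideanSpace ℝ (Fin 3))) (p : Hsp → ℝ → (UnitAddTorus (Fin 3)) → ℝ)

/-- **`∂ₜu_y(s)` and `Δ∂ₜu_y(s)` are honest** (two-sided time derivative at `s ∈ (0, 3)`, read on the window
`[s/2, (s + 3)/2]`). [folklore] -/
theorem honest_timeDeriv (hsol : ∀ y ∈ U, IsClassicalNSSolutionOn (Ioc 0 3) ν (fun _ => force S c) (u y) (p y))
    (hzm : ∀ y ∈ U, ∀ t ∈ Ioc (0 : ℝ) 3, HasZeroMean (u y t)) {y : Hsp} (hy : y ∈ U) {s : ℝ} (hs : s ∈ Ioo (0 : ℝ) 3) :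
    (IsSmooth (Torus.timeDeriv (u y) s) ∧ IsDivFree (Torus.timeDeriv (u y) s) ∧ HasZeroMean (Torus.timeDeriv (u y) s)) ∧
      (IsSmooth (laplacian (Torus.timeDeriv (u y) s)) ∧ IsDivFree (laplacian (Torus.timeDeriv (u y) s)) ∧
        HasZeroMean (laplacian (Torus.timeDeriv (u y) s))) := by
  have ha : 0 < s / 2 := by linarith [hs.1]
  have hab : s / 2 < (s + 3) / 2 := by linarith [hs.2]
  have hb : (s + 3) / 2 ≤ 3 := by linarith [hs.2]
  have hsI : s ∈ Ioo (s / 2) ((s + 3) / 2) := ⟨by linarith [hs.1], by linarith [hs.2]⟩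
  have hsI' : s ∈ Icc (s / 2) ((s + 3) / 2) := Ioo_subset_Icc_self hsI
  have hw := isClassicalNSSolutionOn_window u p hsol hy ha hab hb
  have hint : Torus.timeDerivWithin (Icc (s / 2) ((s + 3) / 2)) (u y) s = Torus.timeDeriv (u y) s := by
    funext x
    exact Torus.timeDerivWithin_of_mem_interior (by rw [interior_Icc]; exact hsI) x
  have h1 : IsSmooth (Torus.timeDeriv (u y) s) := hint ▸ hw.smooth_velocity.isSmooth_timeDerivWithin (uniqueDiffOn_Icc hab) hsI'
  have h2 : IsDivFree (Torus.timeDeriv (u y) s) := hint ▸ hw.isDivFree_timeDerivWithin hab hsI'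
  have h3 : HasZeroMean (Torus.timeDeriv (u y) s) :=
    hint ▸ hw.smooth_velocity.hasZeroMean_timeDerivWithin hab (fun r hr => hzm y hy r ⟨ha.trans_le hr.1, hr.2.trans hb⟩) hsI'
  exact ⟨⟨h1, h2, h3⟩, honest_laplacian h1 h2⟩

/-- **The difference of the time derivatives of two orbits' classical solutions is the projected linearisation plus the
projected quadratic defect** (`Torus.IsClassicalNSSolutionOn.timeDerivWithin_sub_eq_leray` on the window `[s/2, (s + 3)/2]`,
two-sided derivatives at the interior time `s`). [folklore] -/
theorem timeDeriv_sub_eq_leray (hsol : ∀ y ∈ U, IsClassicalNSSolutionOn (Ioc 0 3) ν (fun _ => force S c) (u y) (p y))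
    {y y' : Hsp} (hy : y ∈ U) (hy' : y' ∈ U) {s : ℝ} (hs : s ∈ Ioo (0 : ℝ) 3) (x : UnitAddTorus (Fin 3)) :
    Torus.timeDeriv (u y') s x - Torus.timeDeriv (u y) s x =
      (ν • laplacian (fun z => u y' s z - u y s z) x -
          (convect (u y s) (fun z => u y' s z - u y s z) x + convect (fun z => u y' s z - u y s z) (u y s) x) -
          convect (fun z => u y' s z - u y s z) (fun z => u y' s z - u y s z) x) -
        Torus.gradient (invLaplacian (divergence fun w =>
          ν • laplacian (fun z => u y' s z - u y s z) w -
            (convect (u y s) (fun z => u y' s z - u y s z) w + convect (fun z => u y' s z - u y s z) (u y s) w) -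
            convect (fun z => u y' s z - u y s z) (fun z => u y' s z - u y s z) w)) x := by
  have ha : 0 < s / 2 := by linarith [hs.1]
  have hab : s / 2 < (s + 3) / 2 := by linarith [hs.2]
  have hb : (s + 3) / 2 ≤ 3 := by linarith [hs.2]
  have hsI : s ∈ Ioo (s / 2) ((s + 3) / 2) := ⟨by linarith [hs.1], by linarith [hs.2]⟩
  have hw := isClassicalNSSolutionOn_window u p hsol hy ha hab hb
  have hw' := isClassicalNSSolutionOn_window u p hsol hy' ha hab hb
  have h := hw'.timeDerivWithin_sub_eq_leray hw hab (Ioo_subset_Icc_self hsI) x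
  have hmem : s ∈ interior (Icc (s / 2) ((s + 3) / 2)) := by rw [interior_Icc]; exact hsI
  rwa [Torus.timeDerivWithin_of_mem_interior hmem, Torus.timeDerivWithin_of_mem_interior hmem] at h

/-- **Frame norm of a three-term combination of honest states**:
`‖S([A] − [ΔA]) − S([B] − [ΔB]) − S([C] − [ΔC])‖² = ∫‖A − B − C‖² + ‖∇(A − B − C)‖₂²`. [folklore] -/
theorem norm_frame_sub_sub_sq {A B C : (UnitAddTorus (Fin 3)) → (EuclideanSpace ℝ (Fin 3))} (hA : IsSmooth A) (hAd : IsDivFree A)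
    (hAm : HasZeroMean A) (hB : IsSmooth B) (hBd : IsDivFree B) (hBm : HasZeroMean B) (hC : IsSmooth C) (hCd : IsDivFree C)
    (hCm : HasZeroMean C) :
    ‖F.S (stateOf A - stateOf (laplacian A)) - F.S (stateOf B - stateOf (laplacian B)) - F.S (stateOf C - stateOf (laplacian C))‖ ^ 2 =
      (∫ x, ‖A x - B x - C x‖ ^ 2) + gradNormSq (fun x => A x - B x - C x) := by
  obtain ⟨hs, hd, hm⟩ := honest_sub hA hAd hAm hB hBd hBm
  obtain ⟨hΔA, hΔAd, hΔAm⟩ := honest_laplacian hA hAd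
  obtain ⟨hΔB, hΔBd, hΔBm⟩ := honest_laplacian hB hBd
  have hL : laplacian (fun x => A x - B x) = fun x => laplacian A x - laplacian B x := by
    rw [show (fun x => A x - B x) = A - B from rfl, laplacian_sub hA hB]; rfl
  have hAB : F.S (stateOf A - stateOf (laplacian A)) - F.S (stateOf B - stateOf (laplacian B)) =
      F.S (stateOf (fun x => A x - B x) - stateOf (laplacian fun x => A x - B x)) := by
    rw [← map_sub, sub_sub_sub_comm, ← stateOf_sub' hA hAd hAm hB hBd hBm, hL, ← stateOf_sub' hΔA hΔAd hΔAm hΔB hΔBd hΔBm]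
  rw [hAB]
  exact F.norm_frame_sub_sq hs hd hm hC hCd hCm

-- the estimate manipulates large explicit field expressions; give the elaborator room
set_option maxHeartbeats 800000 in
/-- **The time-derivative field is Fréchet differentiable in the datum, with derivative the candidate mixed operator.**  In the
setting of `exists_mixedOp` (operator field `Φ` with its defining formula on the admissible box), at an admissible `(s, y)`
with `s < 3`, the field `y' ↦ S([∂ₜu_{y'}(s)] − [Δ∂ₜu_{y'}(s)])` has Fréchet derivative `Φ s y` at `y`: for `h = y' − y` small,
`‖S([X] − [ΔX])‖² = ‖X‖²_{H¹} ≤ K(ε'‖h‖² + (C₂L²‖h‖²)²) ≤ c²‖h‖²` with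
`X = ∂ₜu_{y'} − ∂ₜu_y − DG(u_y)[w_h]` (`Torus.exists_h1_linearisationRemainder_le` after
`timeDeriv_sub_eq_leray`; the `H³`-sum of `r = (u_{y'} − u_y)(s) − w_h` is `≤ ε'‖h‖²` by Gevrey interpolation, `r` being
Gevrey-bounded by `4C₂L²‖h‖²` with `∫‖r‖² ≤ ‖S‖²‖g s y' − g s y − W h‖²`). [folklore] -/
theorem hasFDerivAt_timeField_frame (hsol : ∀ y ∈ U, IsClassicalNSSolutionOn (Ioc 0 3) ν (fun _ => force S c) (u y) (p y))
    (hzm : ∀ y ∈ U, ∀ t ∈ Ioc (0 : ℝ) 3, HasZeroMean (u y t))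
    (hSu : ∀ y ∈ U, ∀ t ∈ Ioc (0 : ℝ) 3, F.S (F.modelMap ν xF U' t y) = stateOf (u y t)) (hU : IsOpen U)
    (hsmooth : ∀ t ∈ Icc (0 : ℝ) 3, ContDiffOn ℝ ∞ (fun y => F.modelMap ν xF U' t y) U)
    {a σ₁ C₁ σ₂ C₂ : ℝ} (hσ₁ : 0 < σ₁) (hσ₂ : 0 < σ₂) (hC₂ : 0 ≤ C₂)
    (hG₁ : ∀ y ∈ U, ∀ s ∈ Icc (2 * a) 3, ∀ S' : Finset (Fin 3 → ℤ), ∑ k ∈ S', Real.exp (2 * σ₁ * Real.sqrt (freqNormSq k)) *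
        ‖UnitAddTorus.mFourierCoeff (EuclideanSpace.complexify ∘ u y s) k‖ ^ 2 ≤ C₁)
    (hLipG : ∀ y ∈ U, ∀ y' ∈ U, ∀ s ∈ Icc (3 * a) 3, ∀ S' : Finset (Fin 3 → ℤ),
      ∑ k ∈ S', Real.exp (2 * σ₂ * Real.sqrt (freqNormSq k)) *
        ‖UnitAddTorus.mFourierCoeff (EuclideanSpace.complexify ∘ fun x => u y s x - u y' s x) k‖ ^ 2 ≤
        C₂ * ‖F.modelMap ν xF U' (s - a) y - F.modelMap ν xF U' (s - a) y'‖ ^ 2)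
    {ε ρ L r₀ : ℝ} {y₀ : Hsp} (hρ : 0 < ρ) (hballU : ball y₀ ρ ⊆ U)
    (hLip : ∀ r ∈ Icc (r₀ - ε) (r₀ + ε), ∀ y ∈ ball y₀ ρ, ∀ y' ∈ ball y₀ ρ,
      ‖F.modelMap ν xF U' r y - F.modelMap ν xF U' r y'‖ ≤ L * ‖y - y'‖)
    {Φ : ℝ → Hsp → (Hsp →L[ℝ] Hsp)}
    (hΦ : ∀ s ∈ Icc (3 * a) 3, s - a ∈ Icc (r₀ - ε) (r₀ + ε) → ∀ y ∈ ball y₀ (ρ / 2),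
      ∀ (h : Hsp) (w : (UnitAddTorus (Fin 3)) → (EuclideanSpace ℝ (Fin 3))), IsSmooth w → IsDivFree w → HasZeroMean w →
        stateOf w = F.S (fderiv ℝ (fun y' => F.modelMap ν xF U' s y') y h) →
        Φ s y h = F.S (stateOf (fun x => (ν • laplacian w x - (convect (u y s) w x + convect w (u y s) x)) -
            Torus.gradient (invLaplacian (divergence fun z => ν • laplacian w z - (convect (u y s) w z + convect w (u y s) z))) x) -
          stateOf (laplacian fun x => (ν • laplacian w x - (convect (u y s) w x + convect w (u y s) x)) -
            Torus.gradient (invLaplacian (divergence fun z => ν • laplacian w z - (convect (u y s) w z + convect w (u y s) z))) x)))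
    {s : ℝ} (hs : s ∈ Icc (3 * a) 3) (hs0 : 0 < s) (hs3 : s < 3) (hsr : s - a ∈ Icc (r₀ - ε) (r₀ + ε)) {y : Hsp}
    (hy : y ∈ ball y₀ (ρ / 2)) :
    HasFDerivAt (fun y' => F.S (stateOf (Torus.timeDeriv (u y') s) - stateOf (laplacian (Torus.timeDeriv (u y') s)))) (Φ s y) y := by
  obtain ⟨K, hK0, hK⟩ := exists_h1_linearisationRemainder_le (d := Fin 3) (Fintype.card_fin 3) ν σ₁ C₁ σ₂ hσ₁ hσ₂
  have hyρ : y ∈ ball y₀ ρ := ball_subset_ball (by linarith) hy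
  have hyU : y ∈ U := hballU hyρ
  have hsO : s ∈ Ioo (0 : ℝ) 3 := ⟨hs0, hs3⟩
  have hs3' : s ∈ Ioc (0 : ℝ) 3 := ⟨hs0, hs.2⟩
  have hus : IsSmooth (u y s) := (hsol y hyU).smooth_velocity.isSmooth_slice hs3'
  -- the space derivative at `y`
  set W : Hsp →L[ℝ] Hsp := fderiv ℝ (fun y' => F.modelMap ν xF U' s y') y with hW
  have hder : HasFDerivAt (fun y' => F.modelMap ν xF U' s y') W y :=
    (((hsmooth s ⟨hs0.le, hs.2⟩).contDiffAt (hU.mem_nhds hyU)).differentiableAt (by simp)).hasFDerivAt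
  rw [hasFDerivAt_iff_isLittleO, isLittleO_iff]
  intro c₀ hc₀
  -- thresholds
  set ε' : ℝ := c₀ ^ 2 / (2 * (K + 1)) with hε'
  have hε'0 : 0 < ε' := by positivity
  obtain ⟨δ₇, hδ₇, hT7⟩ := exists_sobolev_le_of_gevreyBound_of_l2_le (d := Fin 3) (V := EuclideanSpace ℂ (Fin 3)) σ₂
    (4 * (C₂ * L ^ 2)) hσ₂ (by positivity) 3 ε' hε'0
  set NS : ℝ := ‖F.S‖ with hNS
  have hNS0 : 0 ≤ NS := F.S.opNorm_nonneg
  set η : ℝ := Real.sqrt δ₇ / (NS + 1) with hη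
  have hη0 : 0 < η := by positivity
  set κ : ℝ := c₀ / Real.sqrt (2 * (K * (C₂ * L ^ 2) ^ 2 + 1)) with hκ
  have hκ0 : 0 < κ := by positivity
  have hκsq : K * (C₂ * L ^ 2) ^ 2 * κ ^ 2 ≤ c₀ ^ 2 / 2 := by
    rw [hκ, div_pow, Real.sq_sqrt (by positivity)]
    rw [show K * (C₂ * L ^ 2) ^ 2 * (c₀ ^ 2 / (2 * (K * (C₂ * L ^ 2) ^ 2 + 1))) =
      (K * (C₂ * L ^ 2) ^ 2 * c₀ ^ 2) / (2 * (K * (C₂ * L ^ 2) ^ 2 + 1)) by ring]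
    rw [div_le_iff₀ (by positivity)]
    nlinarith [sq_nonneg c₀, mul_nonneg hK0 (sq_nonneg (C₂ * L ^ 2))]
  -- the eventual conditions on `y'`
  have hev₁ : ∀ᶠ y' in 𝓝 y, ‖F.modelMap ν xF U' s y' - F.modelMap ν xF U' s y - W (y' - y)‖ ≤ η * ‖y' - y‖ :=
    (isLittleO_iff.1 (hasFDerivAt_iff_isLittleO.1 hder)) hη0
  have hev₂ : ∀ᶠ y' in 𝓝 y, y' ∈ ball y₀ (ρ / 2) := isOpen_ball.mem_nhds hy
  have hev₃ : ∀ᶠ y' in 𝓝 y, ‖y' - y‖ < κ := by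
    have h := ball_mem_nhds y hκ0
    filter_upwards [h] with y' hy'
    rwa [mem_ball, dist_eq_norm] at hy'
  filter_upwards [hev₁, hev₂, hev₃] with y' h₁ h₂ h₃
  -- ### the estimate at `y'`
  set h : Hsp := y' - y with hh
  have hy'ρ : y' ∈ ball y₀ ρ := ball_subset_ball (by linarith) h₂
  have hy'U : y' ∈ U := hballU hy'ρ
  obtain ⟨⟨hA, hAd, hAm⟩, -⟩ := honest_timeDeriv u p hsol hzm hy'U hsO
  obtain ⟨⟨hB, hBd, hBm⟩, -⟩ := honest_timeDeriv u p hsol hzm hyU hsO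
  -- the case `h = 0`
  by_cases hh0 : h = 0
  · have hyy : y' = y := by rwa [hh, sub_eq_zero] at hh0
    rw [hh0, map_zero, sub_zero, hyy, sub_self, norm_zero, mul_zero]
  have hhpos : 0 < ‖h‖ := norm_pos_iff.2 hh0
  -- the smooth representative of `S (W h)` and the formula for `Φ s y h`
  obtain ⟨w, hw, hwd, hwm, hwG, hst⟩ := exists_smooth_rep_fderiv F xF u p hsol hzm hSu hU hsmooth hσ₂ hC₂ hLipG hρ hballU
    hLip hs hs0 hsr hy h
  obtain ⟨⟨hC, hCd, hCm⟩, -⟩ := honest_leray_linearisation ν hus ((hsol y hyU).divFree s hs3') hw hwd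
  rw [hΦ s hs hsr y hy h w hw hwd hwm hst]
  -- `δ = u_{y'}(s) − u_y(s)` and `r = δ − w`
  obtain ⟨hδ, hδd, hδm⟩ := honest_sub ((hsol y' hy'U).smooth_velocity.isSmooth_slice hs3') ((hsol y' hy'U).divFree s hs3')
    (hzm y' hy'U s hs3') hus ((hsol y hyU).divFree s hs3') (hzm y hyU s hs3')
  have hδG : ∀ S' : Finset (Fin 3 → ℤ), ∑ k ∈ S', Real.exp (2 * σ₂ * Real.sqrt (freqNormSq k)) *
      ‖UnitAddTorus.mFourierCoeff (EuclideanSpace.complexify ∘ fun x => u y' s x - u y s x) k‖ ^ 2 ≤ C₂ * L ^ 2 * ‖h‖ ^ 2 := by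
    intro S'
    have hG := hLipG y' hy'U y hyU s hs S'
    have hLn := hLip (s - a) hsr y' hy'ρ y hyρ
    have hsq : ‖F.modelMap ν xF U' (s - a) y' - F.modelMap ν xF U' (s - a) y‖ ^ 2 ≤ (L * ‖h‖) ^ 2 :=
      pow_le_pow_left₀ (norm_nonneg _) hLn 2
    calc _ ≤ C₂ * ‖F.modelMap ν xF U' (s - a) y' - F.modelMap ν xF U' (s - a) y‖ ^ 2 := hG
      _ ≤ C₂ * (L * ‖h‖) ^ 2 := mul_le_mul_of_nonneg_left hsq hC₂
      _ = C₂ * L ^ 2 * ‖h‖ ^ 2 := by ring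
  obtain ⟨hr, hrd, hrm⟩ := honest_sub hδ hδd hδm hw hwd hwm
  have hrG : ∀ S' : Finset (Fin 3 → ℤ), ∑ k ∈ S', Real.exp (2 * σ₂ * Real.sqrt (freqNormSq k)) *
      ‖UnitAddTorus.mFourierCoeff (EuclideanSpace.complexify ∘ fun x => (u y' s x - u y s x) - w x) k‖ ^ 2 ≤
      4 * (C₂ * L ^ 2) * ‖h‖ ^ 2 := fun S' =>
    (gevrey_sub_le hδ hw hδG hwG S').trans (by ring_nf; rfl)
  -- `∫‖r‖² = ‖S(g s y' − g s y − W h)‖² ≤ δ₇ ‖h‖²`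
  have hrL2 : (∫ x, ‖(u y' s x - u y s x) - w x‖ ^ 2) ≤ δ₇ * ‖h‖ ^ 2 := by
    have heq : stateOf (fun x => u y' s x - u y s x) - stateOf w =
        F.S (F.modelMap ν xF U' s y' - F.modelMap ν xF U' s y - W (y' - y)) := by
      rw [stateOf_sub' ((hsol y' hy'U).smooth_velocity.isSmooth_slice hs3') ((hsol y' hy'U).divFree s hs3') (hzm y' hy'U s hs3')
        hus ((hsol y hyU).divFree s hs3') (hzm y hyU s hs3'), hst, ← hSu y' hy'U s hs3', ← hSu y hyU s hs3', ← map_sub, ← map_sub]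
    rw [← norm_stateOf_sub_sq hδ hδd hδm hw hwd hwm, heq]
    have h1 : ‖F.S (F.modelMap ν xF U' s y' - F.modelMap ν xF U' s y - W (y' - y))‖ ≤ NS * (η * ‖h‖) :=
      (F.S.le_opNorm _).trans (mul_le_mul_of_nonneg_left h₁ hNS0)
    have h2 : NS * η ≤ Real.sqrt δ₇ := by
      rw [hη, mul_div_assoc']
      rw [div_le_iff₀ (by positivity)]
      nlinarith [Real.sqrt_nonneg δ₇]
    have h3 : (NS * (η * ‖h‖)) ^ 2 ≤ δ₇ * ‖h‖ ^ 2 := by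
      rw [show NS * (η * ‖h‖) = (NS * η) * ‖h‖ by ring, mul_pow]
      have h4 : (NS * η) ^ 2 ≤ δ₇ := by
        calc (NS * η) ^ 2 ≤ Real.sqrt δ₇ ^ 2 := pow_le_pow_left₀ (by positivity) h2 2
          _ = δ₇ := Real.sq_sqrt hδ₇.le
      exact mul_le_mul_of_nonneg_right h4 (sq_nonneg _)
    exact (pow_le_pow_left₀ (norm_nonneg _) h1 2).trans h3
  -- the `H³`-sum of `r` is `≤ ε' ‖h‖²`
  have hrSob := sobolev_le_of_interp hT7 hr hhpos hrG hrL2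
  -- the remainder estimate
  have hrem := hK (u y s) (fun x => u y' s x - u y s x) w hus hδ hw hrm (hG₁ y hyU s ⟨by linarith [hs.1], hs.2⟩)
    (C₂ * L ^ 2 * ‖h‖ ^ 2) hδG (ε' * ‖h‖ ^ 2) hrSob
  -- the frame norm of the three-term combination
  have hsq : ‖F.S (stateOf (Torus.timeDeriv (u y') s) - stateOf (laplacian (Torus.timeDeriv (u y') s))) -
      F.S (stateOf (Torus.timeDeriv (u y) s) - stateOf (laplacian (Torus.timeDeriv (u y) s))) -
      F.S (stateOf (fun x => (ν • laplacian w x - (convect (u y s) w x + convect w (u y s) x)) -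
            Torus.gradient (invLaplacian (divergence fun z => ν • laplacian w z - (convect (u y s) w z + convect w (u y s) z))) x) -
          stateOf (laplacian fun x => (ν • laplacian w x - (convect (u y s) w x + convect w (u y s) x)) -
            Torus.gradient (invLaplacian (divergence fun z => ν • laplacian w z - (convect (u y s) w z + convect w (u y s) z))) x))‖ ^ 2 ≤
      (c₀ * ‖h‖) ^ 2 := by
    rw [norm_frame_sub_sub_sq F hA hAd hAm hB hBd hBm hC hCd hCm]
    simp only [timeDeriv_sub_eq_leray u p hsol hyU hy'U hsO]
    refine hrem.trans ?_
    have e1 : K * (ε' * ‖h‖ ^ 2) ≤ c₀ ^ 2 / 2 * ‖h‖ ^ 2 := by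
      have : K * ε' ≤ c₀ ^ 2 / 2 := by
        rw [hε', show K * (c₀ ^ 2 / (2 * (K + 1))) = (K * c₀ ^ 2) / (2 * (K + 1)) by ring, div_le_iff₀ (by positivity)]
        nlinarith [sq_nonneg c₀]
      nlinarith [sq_nonneg ‖h‖]
    have e2 : K * (C₂ * L ^ 2 * ‖h‖ ^ 2) ^ 2 ≤ c₀ ^ 2 / 2 * ‖h‖ ^ 2 := by
      have hh2 : ‖h‖ ^ 2 ≤ κ ^ 2 := pow_le_pow_left₀ (norm_nonneg _) h₃.le 2
      calc K * (C₂ * L ^ 2 * ‖h‖ ^ 2) ^ 2 = (K * (C₂ * L ^ 2) ^ 2 * ‖h‖ ^ 2) * ‖h‖ ^ 2 := by ring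
        _ ≤ (K * (C₂ * L ^ 2) ^ 2 * κ ^ 2) * ‖h‖ ^ 2 :=
            mul_le_mul_of_nonneg_right (mul_le_mul_of_nonneg_left hh2 (by positivity)) (sq_nonneg _)
        _ ≤ c₀ ^ 2 / 2 * ‖h‖ ^ 2 := mul_le_mul_of_nonneg_right hκsq (sq_nonneg _)
    nlinarith [e1, e2]
  exact (pow_le_pow_iff_left₀ (norm_nonneg _) (by positivity) two_ne_zero).1 hsq

end Deriv

end Summit.AnomalousDissipation.AnomalousDissipation.Theorems.DenseLoudDesignerForces.Ergodic

end
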